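import Summits.QuantumFields.YangMills.Theses.LangevinControlUV
import Literature.MathematicalPhysics.QuantumFieldTheory.MassGapToLatticeClustering
import Literature.MathematicalPhysics.QuantumFieldTheory.DiagonalLatticeClustering

/-!
# Strategy census r1 (second opinion) — kernel-checked companion
# crux `GapToContinuum` (stmt-QuantumFields-8896), route `LangevinControlUV`

Unit `cstrat-stmt-QuantumFields-8896-r1` (redirect strategist, 2026-08-17).  Companion of the r1
`STRATEGY-CENSUS.md`.  Nothing here is proposed to the tree; every statement is logic over tree
declarations, so that the census claims are about THESE signatures and not about prose.
`lean check`: rc 0, 0 `sorry` expected.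

What is NEW relative to the p1 companion `StrategyCensus.lean` (which records one-way glue
`Sub → crux` only):

* §1 **Lattice normal form (EQUIVALENCES).**  Along `IsYangMillsFor r sch T` the continuum gap clause
  `T.HasMassGap Δ` IS a lattice clause: `sch.HasCSClustering r Δ ↔ T.HasMassGap Δ` and
  `sch.HasDiagClustering r Δ ↔ T.HasMassGap Δ` (YM instances of the tree's converse
  `OSData.clustersCS_of_hasMassGap`, landed for QCD as
  `IsQCDAlong.hasSpeciesCSClustering_iff_hasMassGap`).  Hence the typed crux is EQUIVALENT — not
  merely implied by — the lattice-to-lattice upgrade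
  `IsYangMillsFor → HasLatticeMassGap → sch.HasCSClustering` (`gapToContinuum_iff_latticeUpgradeCS`,
  `…Diag`), and `T` enters ONLY through the existence of SOME Osterwalder–Schrader continuum limit of
  the scheme (`gapToContinuum_iff_latticeUpgradeExists`).  Reading: 8896 has no continuum content;
  it asserts that along EVERY Wilson scheme (any compact `G`, any real couplings `β_k`, any volumes
  with `a_k L_k → ∞`, any renormalisations) admitting an OS limit, per-pair sup-norm clustering of
  FIXED lattice-local observables on all large tori upgrades to OS-currency clustering of the
  `k`-GROWING family of renormalised smeared PRODUCT fields on the scheme's OWN tori.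
* §2 **`T` is idle in the threshold half.**  The registered birth skeleton (`Lines/birth.lean`)
  cuts the crux as `stub_thresholdUniformity` (D2) → `stub_uniformTransfer` (D3b) → R5.  Stub 1 is
  EQUIVALENT to a `T`-FREE statement about Wilson lattice gauge theory at ARBITRARY couplings
  (`thresholdUpgrade_iff_free`: strip the renormalisations to `c = m = 0`; the vacuum datum is then a
  Wilson continuum limit of the stripped scheme, which has the same `(a, β, L)`), i.e. "per-pair
  exponential clustering at rate `Δ a_k` ⇒ pair-uniform onset" for every compact `G` and every
  coupling sequence — the global form of lead c3's fixed-`G` certificate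
  `BirthStubThresholdIdleC3.lean::stub_thresholdUniformity_iff_latticeOnly`.  Stub 2 is EQUIVALENT to the crux with
  its hypothesis strengthened to the pair-uniform lattice gap (`uniformTransfer_iff_gapToContinuumU`),
  the shape of OneCertifiedCube's stmt-16126 minus `HasWeakCouplingLimit`, graded misstated (D3b) by
  that sibling's leads; and the typed crux implies it (`gapToContinuumU_of_gapToContinuum`).
* §3 **New split candidates of this pass** with kernel-checked glue, each with the child that carries
  the whole difficulty named in the `.md`: group-class split (`gapToContinuum_of_groupSplit`),
  tame/wild scheme split (`gapToContinuum_of_tameSplit`).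
* §4 **Negation normal form in lattice currency** (`not_gapToContinuum_iff_lattice`): a witness
  against the crux is a Wilson scheme with an OS continuum limit whose OWN-torus renormalised
  `n`-point functions violate the slack-`ε` Cauchy–Schwarz inequality at some `t` frequently in `k`,
  while every fixed pair clusters — the failure must be visible on the lattice, but the scheme must
  still HAVE an `O(4)`-invariant reflection-positive limit for ALL species strings.
-/

noncomputable section

open scoped SchwartzMap
open MeasureTheory Filter Topology
open Literature.MathematicalPhysics.AQFT Literature.MathematicalPhysics.QuantumLattice
open Literature.MathematicalPhysics.QuantumFieldTheory Literature.Probability.LatticeModels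

namespace Summit.QuantumFields.YangMills.Cruxes.GapToContinuum.StrategyCensusR1

open Summit.QuantumFields.YangMills.Theses.LangevinControlUV

/-! ## §0 The two YM instances of the tree's converse transfer -/

section Instances

variable {G : Type} [Group G] [TopologicalSpace G] [IsTopologicalGroup G] [CompactSpace G]
  [MeasurableSpace G] [BorelSpace G]

/-- **CS clustering of lattice Yang–Mills FROM the continuum gap** (YM instance of
`OSData.clustersCS_of_hasMassGap`; the QCD instance is landed as
`IsQCDAlong.hasSpeciesCSClustering_of_hasMassGap`). -/
theorem hasCSClustering_of_hasMassGap {r : LatticeRep G} {sch : SpeciesScheme (YMSpecies G)}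
    {T : OSData (YMSpecies G) 4} (hT : IsYangMillsFor r sch T) {Δ : ℝ} (h : T.HasMassGap Δ) :
    sch.HasCSClustering r Δ :=
  OSData.clustersCS_of_hasMassGap T _ hT h

/-- **Along `IsYangMillsFor`, CS clustering IS the continuum gap clause.** -/
theorem hasCSClustering_iff_hasMassGap {r : LatticeRep G} {sch : SpeciesScheme (YMSpecies G)}
    {T : OSData (YMSpecies G) 4} (hT : IsYangMillsFor r sch T) (Δ : ℝ) :
    sch.HasCSClustering r Δ ↔ T.HasMassGap Δ :=
  ⟨hT.hasMassGap_of_hasCSClustering, hasCSClustering_of_hasMassGap hT⟩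

/-- **Along `IsYangMillsFor`, diagonal clustering IS the continuum gap clause.** -/
theorem hasDiagClustering_iff_hasMassGap {r : LatticeRep G} {sch : SpeciesScheme (YMSpecies G)}
    {T : OSData (YMSpecies G) 4} (hT : IsYangMillsFor r sch T) (Δ : ℝ) :
    sch.HasDiagClustering r Δ ↔ T.HasMassGap Δ :=
  ⟨hT.hasMassGap_of_hasDiagClustering,
    fun h => hT.hasDiagClustering_of_hasCSClustering (hasCSClustering_of_hasMassGap hT h)⟩

end Instances

/-! ## §1 Lattice normal forms of the typed crux (equivalences) -/

/-- The lattice-to-lattice upgrade in Cauchy–Schwarz currency (verbatim p1's `SubLatticeUpgrade`,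
the dead stub of lines `Sketch`/`HeavyLemma` without the β-sign split). -/
def LatticeUpgradeCS : Prop :=
  ∀ (G : Type) [Group G] [TopologicalSpace G] [IsTopologicalGroup G] [CompactSpace G]
    [MeasurableSpace G] [BorelSpace G] (r : LatticeRep G) (sch : SpeciesScheme (YMSpecies G))
    (T : OSData (YMSpecies G) 4) (Δ : ℝ), 0 < Δ → IsYangMillsFor r sch T →
      HasLatticeMassGap r sch Δ → sch.HasCSClustering r Δ

/-- The lattice-to-lattice upgrade in diagonal currency (verbatim the composite of the two birth
stubs; the lattice form of lead a1's diagonal core). -/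
def LatticeUpgradeDiag : Prop :=
  ∀ (G : Type) [Group G] [TopologicalSpace G] [IsTopologicalGroup G] [CompactSpace G]
    [MeasurableSpace G] [BorelSpace G] (r : LatticeRep G) (sch : SpeciesScheme (YMSpecies G))
    (T : OSData (YMSpecies G) 4) (Δ : ℝ), 0 < Δ → IsYangMillsFor r sch T →
      HasLatticeMassGap r sch Δ → sch.HasDiagClustering r Δ

/-- The same with `T` eliminated down to the EXISTENCE of an OS continuum limit of the scheme. -/
def LatticeUpgradeExists : Prop :=
  ∀ (G : Type) [Group G] [TopologicalSpace G] [IsTopologicalGroup G] [CompactSpace G]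
    [MeasurableSpace G] [BorelSpace G] (r : LatticeRep G) (sch : SpeciesScheme (YMSpecies G))
    (Δ : ℝ), 0 < Δ → HasLatticeMassGap r sch Δ →
      (∃ T : OSData (YMSpecies G) 4, IsYangMillsFor r sch T) → sch.HasCSClustering r Δ

/-- **Normal form 1: the crux IS the CS lattice upgrade** (`↔`, not only `←`). -/
theorem gapToContinuum_iff_latticeUpgradeCS : GapToContinuum ↔ LatticeUpgradeCS := by
  constructor
  · intro h G _ _ _ _ _ _ r sch T Δ hΔ hYM hlat
    exact hasCSClustering_of_hasMassGap hYM (h G r sch T Δ hΔ hYM hlat)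
  · intro h G _ _ _ _ _ _ r sch T Δ hΔ hYM hlat
    exact hYM.hasMassGap_of_hasCSClustering (h G r sch T Δ hΔ hYM hlat)

/-- **Normal form 2: the crux IS the diagonal lattice upgrade.** -/
theorem gapToContinuum_iff_latticeUpgradeDiag : GapToContinuum ↔ LatticeUpgradeDiag := by
  constructor
  · intro h G _ _ _ _ _ _ r sch T Δ hΔ hYM hlat
    exact (hasDiagClustering_iff_hasMassGap hYM Δ).2 (h G r sch T Δ hΔ hYM hlat)
  · intro h G _ _ _ _ _ _ r sch T Δ hΔ hYM hlat
    exact hYM.hasMassGap_of_hasDiagClustering (h G r sch T Δ hΔ hYM hlat)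

/-- **Normal form 3: `T` enters only through the existence of SOME OS continuum limit.**  The crux
is a statement about Wilson LATTICE gauge theory along schemes that admit an Osterwalder–Schrader
limit; no property of the limit beyond its existence is used or produced. -/
theorem gapToContinuum_iff_latticeUpgradeExists : GapToContinuum ↔ LatticeUpgradeExists := by
  constructor
  · rintro h G _ _ _ _ _ _ r sch Δ hΔ hlat ⟨T, hYM⟩
    exact hasCSClustering_of_hasMassGap hYM (h G r sch T Δ hΔ hYM hlat)
  · intro h G _ _ _ _ _ _ r sch T Δ hΔ hYM hlat
    exact hYM.hasMassGap_of_hasCSClustering (h G r sch Δ hΔ hlat ⟨T, hYM⟩)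

/-! ## §2 The birth skeleton's two halves, pinned -/

section Strip

variable {ι : Type}

/-- **Stripping a scheme**: same spacings, couplings and volumes, all renormalisations zero. -/
def strip (sch : SpeciesScheme ι) : SpeciesScheme ι :=
  { sch with c := fun _ _ => 0, m := fun _ _ => 0 }

@[simp] theorem strip_a (sch : SpeciesScheme ι) : (strip sch).a = sch.a := rfl
@[simp] theorem strip_β (sch : SpeciesScheme ι) : (strip sch).β = sch.β := rfl
@[simp] theorem strip_L (sch : SpeciesScheme ι) : (strip sch).L = sch.L := rfl
@[simp] theorem strip_c (sch : SpeciesScheme ι) (s : ι) (k : ℕ) : (strip sch).c s k = 0 := rfl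
@[simp] theorem strip_m (sch : SpeciesScheme ι) (s : ι) (k : ℕ) : (strip sch).m s k = 0 := rfl

variable {G : Type} [Group G] [TopologicalSpace G] [IsTopologicalGroup G] [CompactSpace G]
  [MeasurableSpace G] [BorelSpace G]

/-- **The vacuum datum is a Wilson continuum limit of EVERY stripped scheme** (every smeared field
vanishes identically; cf. the tree's `isYangMillsFor_vacuum` for the zero scheme). -/
theorem isYangMillsFor_strip_vacuum (r : LatticeRep G) (sch : SpeciesScheme (YMSpecies G)) :
    IsYangMillsFor r (strip sch) (OSData.vacuum (YMSpecies G) 4) := by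
  intro n hn σ f F _ _
  have hS : (OSData.vacuum (YMSpecies G) 4).schwinger n σ F = 0 := by
    simp [OSData.vacuum, LabelledSchwingerFamily.trivial_of_ne_zero (YMSpecies G) hn]
  rw [hS]
  refine tendsto_const_nhds.congr' (Eventually.of_forall fun k => ?_)
  show (0 : ℂ) = ((latticeSchwinger r.ρ (strip sch) (fun s => s.F) k n σ f : ℝ) : ℂ)
  obtain ⟨j, rfl⟩ := Nat.exists_eq_succ_of_ne_zero hn
  simp [latticeSchwinger, smearedLatticeField, strip]

/-- `HasLatticeMassGap` does not read the renormalisations. -/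
theorem hasLatticeMassGap_strip_iff (r : LatticeRep G) (sch : SpeciesScheme (YMSpecies G))
    (Δ : ℝ) : HasLatticeMassGap r (strip sch) Δ ↔ HasLatticeMassGap r sch Δ := Iff.rfl

end Strip

/-- **Pair-uniform lattice gap** (one threshold `k₀` for all pairs; constants still per pair): the
conclusion of birth stub 1 / antecedent of birth stub 2 / the lattice clause of stmt-16126. -/
def UniformLatticeGap {G : Type} [Group G] [TopologicalSpace G] [IsTopologicalGroup G]
    [CompactSpace G] [MeasurableSpace G] [BorelSpace G] (r : LatticeRep G)
    (sch : SpeciesScheme (YMSpecies G)) (Δ : ℝ) : Prop :=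
  ∃ k₀ : ℕ, ∀ A B : YMSpecies G, ∃ C : ℝ, ∀ k : ℕ, k₀ ≤ k → ∀ S : ℕ, sch.L k ≤ S →
    ∀ n : ℕ, n ≤ S →
      |latticeConnectedCorr r.ρ (sch.β k) (2 * S + 1) A.F B.F n| ≤
        C * Real.exp (-(Δ * (sch.a k * n)))

/-- Birth stub 1 (`stub_thresholdUniformity`), verbatim as a `Prop`. -/
def ThresholdUpgrade : Prop :=
  ∀ (G : Type) [Group G] [TopologicalSpace G] [IsTopologicalGroup G] [CompactSpace G]
    [MeasurableSpace G] [BorelSpace G] (r : LatticeRep G) (sch : SpeciesScheme (YMSpecies G))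
    (T : OSData (YMSpecies G) 4) (Δ : ℝ), 0 < Δ → IsYangMillsFor r sch T →
      HasLatticeMassGap r sch Δ → UniformLatticeGap r sch Δ

/-- Birth stub 1 with `T` and `IsYangMillsFor` DELETED: a statement about Wilson lattice gauge
theory at an ARBITRARY real coupling sequence (every compact `G`). -/
def ThresholdUpgradeFree : Prop :=
  ∀ (G : Type) [Group G] [TopologicalSpace G] [IsTopologicalGroup G] [CompactSpace G]
    [MeasurableSpace G] [BorelSpace G] (r : LatticeRep G) (sch : SpeciesScheme (YMSpecies G))
    (Δ : ℝ), 0 < Δ → HasLatticeMassGap r sch Δ → UniformLatticeGap r sch Δ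

/-- **`T` is idle in birth stub 1**: the stub is EQUIVALENT to its `T`-free form.  (`→`: apply the
stub to the stripped scheme and the vacuum datum; hypothesis and conclusion read only `(a, β, L)`.) -/
theorem thresholdUpgrade_iff_free : ThresholdUpgrade ↔ ThresholdUpgradeFree := by
  constructor
  · intro h G _ _ _ _ _ _ r sch Δ hΔ hlat
    exact h G r (strip sch) (OSData.vacuum _ 4) Δ hΔ (isYangMillsFor_strip_vacuum r sch) hlat
  · intro h G _ _ _ _ _ _ r sch T Δ hΔ _ hlat
    exact h G r sch Δ hΔ hlat

/-- Birth stub 2 (`stub_uniformTransfer`), verbatim as a `Prop`. -/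
def UniformTransfer : Prop :=
  ∀ (G : Type) [Group G] [TopologicalSpace G] [IsTopologicalGroup G] [CompactSpace G]
    [MeasurableSpace G] [BorelSpace G] (r : LatticeRep G) (sch : SpeciesScheme (YMSpecies G))
    (T : OSData (YMSpecies G) 4) (Δ : ℝ), 0 < Δ → IsYangMillsFor r sch T →
      UniformLatticeGap r sch Δ → sch.HasDiagClustering r Δ

/-- The typed crux with its lattice hypothesis STRENGTHENED to the pair-uniform gap (the shape of
OneCertifiedCube's stmt-16126 without `HasWeakCouplingLimit`). -/
def GapToContinuumU : Prop :=
  ∀ (G : Type) [Group G] [TopologicalSpace G] [IsTopologicalGroup G] [CompactSpace G]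
    [MeasurableSpace G] [BorelSpace G] (r : LatticeRep G) (sch : SpeciesScheme (YMSpecies G))
    (T : OSData (YMSpecies G) 4) (Δ : ℝ), 0 < Δ → IsYangMillsFor r sch T →
      UniformLatticeGap r sch Δ → T.HasMassGap Δ

/-- **Birth stub 2 IS the uniform-threshold crux** (a strict-looking weakening of the typed crux). -/
theorem uniformTransfer_iff_gapToContinuumU : UniformTransfer ↔ GapToContinuumU := by
  constructor
  · intro h G _ _ _ _ _ _ r sch T Δ hΔ hYM hU
    exact hYM.hasMassGap_of_hasDiagClustering (h G r sch T Δ hΔ hYM hU)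
  · intro h G _ _ _ _ _ _ r sch T Δ hΔ hYM hU
    exact (hasDiagClustering_iff_hasMassGap hYM Δ).2 (h G r sch T Δ hΔ hYM hU)

/-- A pair-uniform gap is in particular a per-pair gap. -/
theorem hasLatticeMassGap_of_uniformLatticeGap {G : Type} [Group G] [TopologicalSpace G]
    [IsTopologicalGroup G] [CompactSpace G] [MeasurableSpace G] [BorelSpace G]
    {r : LatticeRep G} {sch : SpeciesScheme (YMSpecies G)} {Δ : ℝ}
    (h : UniformLatticeGap r sch Δ) : HasLatticeMassGap r sch Δ := by
  obtain ⟨k₀, hk₀⟩ := h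
  intro A B
  obtain ⟨C, hC⟩ := hk₀ A B
  exact ⟨C, (eventually_ge_atTop k₀).mono fun k hk S hS n hn => hC k hk S hS n hn⟩

/-- The typed crux implies its uniform-threshold weakening (so birth stub 2 is NECESSARY). -/
theorem gapToContinuumU_of_gapToContinuum (h : GapToContinuum) : GapToContinuumU :=
  fun G _ _ _ _ _ _ r sch T Δ hΔ hYM hU =>
    h G r sch T Δ hΔ hYM (hasLatticeMassGap_of_uniformLatticeGap hU)

/-- **The birth split, glue re-derived**: stub 1 → stub 2 → crux. -/
theorem gapToContinuum_of_birth (h₁ : ThresholdUpgrade) (h₂ : UniformTransfer) : GapToContinuum :=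
  fun G _ _ _ _ _ _ r sch T Δ hΔ hYM hlat =>
    hYM.hasMassGap_of_hasDiagClustering (h₂ G r sch T Δ hΔ hYM (h₁ G r sch T Δ hΔ hYM hlat))

/-- Conversely the crux gives back stub 2 but NOT stub 1 (stub 1 is a `T`-free universal lattice
statement, `thresholdUpgrade_iff_free`; nothing continuum-side can produce it).  Recorded: the crux
sits strictly between `ThresholdUpgrade ∧ UniformTransfer` and `UniformTransfer` unless
`ThresholdUpgradeFree` is decided. -/
theorem birth_residual (h : GapToContinuum) : UniformTransfer :=
  uniformTransfer_iff_gapToContinuumU.2 (gapToContinuumU_of_gapToContinuum h)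

/-! ## §3 New split candidates of this pass (glue only; the `.md` names the child that is the crux) -/

/-- **D₆ group-class split, child S**: the crux at compact SIMPLE Lie `G` (the only case `closes`
instantiates). -/
def SubSimple : Prop :=
  ∀ (G : Type) [Group G] [TopologicalSpace G] [IsTopologicalGroup G] [CompactSpace G]
    [MeasurableSpace G] [BorelSpace G], IsCompactSimpleLieGroup G →
    ∀ (r : LatticeRep G) (sch : SpeciesScheme (YMSpecies G))
    (T : OSData (YMSpecies G) 4) (Δ : ℝ), 0 < Δ → IsYangMillsFor r sch T →
      HasLatticeMassGap r sch Δ → T.HasMassGap Δ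

/-- **D₆ child N**: the crux at compact NON-simple `G` (abelian, finite, products, non-connected…). -/
def SubNonSimple : Prop :=
  ∀ (G : Type) [Group G] [TopologicalSpace G] [IsTopologicalGroup G] [CompactSpace G]
    [MeasurableSpace G] [BorelSpace G], ¬ IsCompactSimpleLieGroup G →
    ∀ (r : LatticeRep G) (sch : SpeciesScheme (YMSpecies G))
    (T : OSData (YMSpecies G) 4) (Δ : ℝ), 0 < Δ → IsYangMillsFor r sch T →
      HasLatticeMassGap r sch Δ → T.HasMassGap Δ

/-- D₆ glue (excluded middle on simplicity). -/
theorem gapToContinuum_of_groupSplit (hS : SubSimple) (hN : SubNonSimple) : GapToContinuum := by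
  intro G _ _ _ _ _ _ r sch T Δ hΔ hYM hlat
  by_cases hG : IsCompactSimpleLieGroup G
  · exact hS G hG r sch T Δ hΔ hYM hlat
  · exact hN G hG r sch T Δ hΔ hYM hlat

/-- **Tame schemes**: weak coupling `β_k → +∞`, eventually non-negative coupling (odd-torus link
reflection positivity), physical volume outgrowing the logarithm of the cutoff, and polynomially
bounded renormalisations — the side conditions under which the sibling transfer R6
(`gapToContinuum_slabTransfer`, p127362) operates. -/
def IsTame {ι : Type} (sch : SpeciesScheme ι) : Prop :=
  sch.HasWeakCouplingLimit ∧ (∀ᶠ k in atTop, 0 ≤ sch.β k) ∧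
    Tendsto (fun k => sch.a k * sch.L k / Real.log (sch.a k)⁻¹) atTop atTop ∧
    ∀ s, ∃ (q : ℕ) (K : ℝ), ∀ k, |sch.c s k| ≤ K * ((sch.a k)⁻¹) ^ q ∧ |sch.m s k| ≤ K * ((sch.a k)⁻¹) ^ q

/-- **D₇ tame/wild split, child T**: the crux on tame schemes. -/
def SubTame : Prop :=
  ∀ (G : Type) [Group G] [TopologicalSpace G] [IsTopologicalGroup G] [CompactSpace G]
    [MeasurableSpace G] [BorelSpace G] (r : LatticeRep G) (sch : SpeciesScheme (YMSpecies G))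
    (T : OSData (YMSpecies G) 4) (Δ : ℝ), IsTame sch → 0 < Δ → IsYangMillsFor r sch T →
      HasLatticeMassGap r sch Δ → T.HasMassGap Δ

/-- **D₇ child W**: the crux on wild schemes (bounded-β stretches, negative couplings, volumes
`a_k L_k ≲ log(1/a_k)`, super-polynomial renormalisations). -/
def SubWild : Prop :=
  ∀ (G : Type) [Group G] [TopologicalSpace G] [IsTopologicalGroup G] [CompactSpace G]
    [MeasurableSpace G] [BorelSpace G] (r : LatticeRep G) (sch : SpeciesScheme (YMSpecies G))
    (T : OSData (YMSpecies G) 4) (Δ : ℝ), ¬ IsTame sch → 0 < Δ → IsYangMillsFor r sch T →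
      HasLatticeMassGap r sch Δ → T.HasMassGap Δ

/-- D₇ glue (excluded middle on tameness). -/
theorem gapToContinuum_of_tameSplit (hT : SubTame) (hW : SubWild) : GapToContinuum := by
  intro G _ _ _ _ _ _ r sch T Δ hΔ hYM hlat
  by_cases hs : IsTame sch
  · exact hT G r sch T Δ hs hΔ hYM hlat
  · exact hW G r sch T Δ hs hΔ hYM hlat

/-- **Child T of D₇ still contains the threshold defect D2**: on tame schemes the crux factors as
(tame threshold upgrade) → (tame uniform transfer), and the first factor is again `T`-idle — a
universal statement about weak-coupling Wilson theory of EVERY compact `G` along EVERY tame coupling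
sequence.  Glue of that factorisation: -/
theorem subTame_of_factors
    (h₁ : ∀ (G : Type) [Group G] [TopologicalSpace G] [IsTopologicalGroup G] [CompactSpace G]
      [MeasurableSpace G] [BorelSpace G] (r : LatticeRep G) (sch : SpeciesScheme (YMSpecies G))
      (Δ : ℝ), IsTame sch → 0 < Δ → HasLatticeMassGap r sch Δ → UniformLatticeGap r sch Δ)
    (h₂ : ∀ (G : Type) [Group G] [TopologicalSpace G] [IsTopologicalGroup G] [CompactSpace G]
      [MeasurableSpace G] [BorelSpace G] (r : LatticeRep G) (sch : SpeciesScheme (YMSpecies G))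
      (T : OSData (YMSpecies G) 4) (Δ : ℝ), IsTame sch → 0 < Δ → IsYangMillsFor r sch T →
        UniformLatticeGap r sch Δ → sch.HasDiagClustering r Δ) :
    SubTame :=
  fun G _ _ _ _ _ _ r sch T Δ hs hΔ hYM hlat =>
    hYM.hasMassGap_of_hasDiagClustering (h₂ G r sch T Δ hs hΔ hYM (h₁ G r sch Δ hs hΔ hlat))

/-! ## §4 Negation normal form in lattice currency -/

/-- **A witness against the crux is a LATTICE computation along a scheme that still has an OS
limit**: some compact linear `G`, `r`, scheme, `Δ > 0` with per-pair clustering and SOME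
Osterwalder–Schrader limit `T` of all its renormalised species `n`-point functions, whose own-torus
`n`-point functions violate the slack-`ε` Cauchy–Schwarz clustering `sch.HasCSClustering r Δ`. -/
theorem not_gapToContinuum_iff_lattice :
    ¬ GapToContinuum ↔
      ∃ (G : Type) (_ : Group G) (_ : TopologicalSpace G) (_ : IsTopologicalGroup G)
        (_ : CompactSpace G) (_ : MeasurableSpace G) (_ : BorelSpace G) (r : LatticeRep G)
        (sch : SpeciesScheme (YMSpecies G)) (Δ : ℝ), 0 < Δ ∧ HasLatticeMassGap r sch Δ ∧
          (∃ T : OSData (YMSpecies G) 4, IsYangMillsFor r sch T) ∧ ¬ sch.HasCSClustering r Δ := by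
  rw [gapToContinuum_iff_latticeUpgradeExists]
  unfold LatticeUpgradeExists
  push Not
  constructor
  · rintro ⟨G, i1, i2, i3, i4, i5, i6, r, sch, Δ, hΔ, hlat, hT, hno⟩
    exact ⟨G, i1, i2, i3, i4, i5, i6, r, sch, Δ, hΔ, hlat, hT, hno⟩
  · rintro ⟨G, i1, i2, i3, i4, i5, i6, r, sch, Δ, hΔ, hlat, hT, hno⟩
    exact ⟨G, i1, i2, i3, i4, i5, i6, r, sch, Δ, hΔ, hlat, hT, hno⟩

/-- **A stripped scheme is never a witness**: its lattice `n`-point functions vanish identically, so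
the slack-`ε` Cauchy–Schwarz inequality holds trivially (the vacuum stratum is inert, cf. the landed
`gapToContinuum_on_zeroCouplingStratum` for the `β ≡ 0` stratum). -/
theorem hasCSClustering_strip {G : Type} [Group G] [TopologicalSpace G] [IsTopologicalGroup G]
    [CompactSpace G] [MeasurableSpace G] [BorelSpace G] (r : LatticeRep G)
    (sch : SpeciesScheme (YMSpecies G)) (Δ : ℝ) : (strip sch).HasCSClustering r Δ :=
  hasCSClustering_of_hasMassGap (isYangMillsFor_strip_vacuum r sch) (OSData.vacuum_hasMassGap Δ)

end Summit.QuantumFields.YangMills.Cruxes.GapToContinuum.StrategyCensusR1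

end
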